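import Summits.CriticalPhenomena.PercolationContinuityZ3.Theorems.PercNearOneGluingNoHeavyQuantMagnetizationCornerFormation
import HarnessLib

/-!
# The near-critical FIELD WINDOW of the magnetization: `M(p_c,γ)/2 ≤ M(p,γ) ≤ 2M(p_c,γ)` for `|p - p_c| ≲ γ/(d·M(p_c,γ))`, and the
# two-regime lower bound `M(p_c+t,γ) ≥ max{√(γ/(2dp_c)) - γ/(4dp_c), t/(p(1-p_c))}` — quant lane, METHOD = differential inequalities
# for `θ` near `p_c`, seat p4 gen 21

builds on p205010 (kernel theorem, internal audit signed; external expert review pending) — used ONLY in §3 (through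
`ChiF.eventually_le_deriv_magnetization_criticalProbI` of `…QuantMagnetizationCornerFormation`); §1–§2 are p205010-free.

Seat `prim-quant-p4`, `--supports stmt-CriticalPhenomena-4575`; pure proofs, no definitions.  Notation: `M(p,γ) = 1 - Z_p(1-γ)`,
`Z_p(t) = clusterGF (zdGraph d) 0 p t`, `M_c(γ) = M(p_c,γ)`, `p_c = criticalProbI d`, `prm = GhostField.prm`.

From Aizenman–Barsky's (1.13) integrated in `1/M` across `p_c` (gen 21, `ChiF.inv_magnetization_sub_le`:
`1/M(q,γ) - 1/M(p,γ) ≤ 2d(1-γ)(p-q)/(γ(1-p))`) and Duminil-Copin–Tassion's (1.12) (`ChiF.magnetization_sub_magnetization_ge`,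
`ChiF.magnetization_criticalProbI_ge_sqrt_sub`):

* §1 **`ChiF.magnetization_le_two_mul_criticalProbI`** — above `p_c`: if `p_c ≤ p < 1` and `(p - p_c)·M_c(γ) ≤ γ(1-p)/(4d(1-γ))` then
  `M(p,γ) ≤ 2M_c(γ)`; **`ChiF.magnetization_criticalProbI_le_two_mul`** — below `p_c`: if `0 < q ≤ p_c` and
  `(p_c - q)·M_c(γ) ≤ γ(1-p_c)/(2d(1-γ))` then `M_c(γ) ≤ 2M(q,γ)`.  So inside the FIELD WINDOW `|p - p_c| ≲ γ/(d M_c(γ))` the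
  magnetization is comparable to its critical value (factor 2), the `γ > 0` analogue of the volume/one-arm windows of gens 11/14
  (`|p - p_c| ≲ 1/(n a_n)`): MF width `≍ √γ` (the scaling crossover `t ≍ h^{1/(βδ)}` with `βδ = 2`); in general `≍ γ^{1-1/δ}`.
* §2 **`ChiF.magnetization_ge_max`** — for `p_c ≤ p < 1`: `M(p,γ) ≥ max{√(γ/(2dp_c)) - γ/(4dp_c), (p - p_c)/(p(1 - p_c))}` (the field regime
  `δ ≥ 2` and the thermal regime `β ≤ 1`, both with explicit constants; MF-sharp in each regime).
* §3 **`ChiF.eventually_deriv_gap_criticalProbI`** (p205010 via `…CornerFormation`): for every `p ∈ (0,p_c)` and `ε > 0`, for all small `γ`: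
  `∂_pM(p_c,γ) - ∂_pM(p,γ) ≥ (1-ε)/(p_c(1-p_c))` — the slope gap across `p_c` does not close while `M(·,γ) → θ` uniformly.

HONEST STATUS.  Elementary consequences of printed inequalities (AB87 (1.13), DCT (1.12)); the window is one-sided in sharpness (valid, not
claimed optimal: true crossover exponent `1/(βδ) ≈ 0.45` vs our `1 - 1/δ ≈ 0.81` in `d = 3`); no rate at `p_c`, no exponent beyond
`δ ≥ 2`, `β ≤ 1`; (T1)/(T2) and the honest sentence unchanged.

References: Aizenman–Barsky, Comm. Math. Phys. 108 (1987) (1.13), Thm 1.2 [AizenmanBarsky1987]; Duminil-Copin–Tassion, Comm. Math. Phys.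
343 (2016) §1.5 (1.12) [DuminilCopinTassionCMP2016]; Grimmett, *Percolation* (1999) §5.3, §10.2 [GrimmettPercolation1999].
-/

noncomputable section

namespace Summit.CriticalPhenomena.PercolationContinuityZ3.Theorems

open MeasureTheory Set Filter Topology Literature.Probability.Percolation Literature.Probability.LatticeModels
open scoped Classical ENNReal

namespace ChiF

variable {d : ℕ}

/-! ### §1. The field window around `p_c` -/

/-- **Above `p_c` the magnetization at most doubles inside the field window**: for `d ≥ 2`, `γ ∈ (0,1)`, `p_c ≤ p < 1` with
`(p - p_c)·M(p_c,γ) ≤ γ(1-p)/(4d(1-γ))`: `M(p,γ) ≤ 2·M(p_c,γ)` (from `1/M(p_c,γ) - 1/M(p,γ) ≤ 2d(1-γ)(p-p_c)/(γ(1-p)) ≤ 1/(2M(p_c,γ))`).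
[cite: AizenmanBarsky1987, (1.13)] -/
theorem magnetization_le_two_mul_criticalProbI (hd : 2 ≤ d) {γ : ℝ} (hγ0 : 0 < γ) (hγ1 : γ < 1) {p : ℝ}
    (hpc : (criticalProbI d : ℝ) ≤ p) (hp1 : p < 1)
    (hwin : (p - criticalProbI d) * (1 - clusterGF (zdGraph d) (0 : Site d) (criticalProbI d) (1 - γ)) ≤
      γ * (1 - p) / (4 * d * (1 - γ))) :
    1 - clusterGF (zdGraph d) (0 : Site d) (GhostField.prm p) (1 - γ) ≤
      2 * (1 - clusterGF (zdGraph d) (0 : Site d) (criticalProbI d) (1 - γ)) := by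
  have hd1 : 1 ≤ d := by omega
  have hd0 : (0 : ℝ) < d := by exact_mod_cast (show 0 < d by omega)
  have h1p : 0 < 1 - p := by linarith
  set Mc := 1 - clusterGF (zdGraph d) (0 : Site d) (criticalProbI d) (1 - γ) with hMc
  set Mp := 1 - clusterGF (zdGraph d) (0 : Site d) (GhostField.prm p) (1 - γ) with hMp
  have hMc0 : 0 < Mc := hγ0.trans_le (gamma_le_one_sub_clusterGF (d := d) (criticalProbI d) hγ0.le hγ1.le)
  have h1γ : 0 < 1 - γ := by linarith
  -- the window gives `2d(1-γ)(p-p_c) Mc ≤ γ(1-p)/2 < γ(1-p)`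
  have hsmall' : 2 * d * (1 - γ) * (p - criticalProbI d) * Mc ≤ γ * (1 - p) / 2 := by
    have := mul_le_mul_of_nonneg_left hwin (by positivity : (0 : ℝ) ≤ 2 * d * (1 - γ))
    have e : 2 * d * (1 - γ) * (γ * (1 - p) / (4 * d * (1 - γ))) = γ * (1 - p) / 2 := by
      field_simp
      norm_num
    nlinarith [this, e]
  have hsmall : 2 * d * (1 - γ) * (p - criticalProbI d) * Mc < γ * (1 - p) := by
    have : 0 < γ * (1 - p) := mul_pos hγ0 h1p
    linarith
  obtain ⟨-, hup⟩ := theta_le_magnetization_criticalProbI_div hd hγ0 hγ1 hpc hp1 hsmall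
  -- denominator `≥ 1/2`
  have hden : 1 / 2 ≤ 1 - 2 * d * (1 - γ) * (p - criticalProbI d) * Mc / (γ * (1 - p)) := by
    rw [le_sub_comm, div_le_iff₀ (mul_pos hγ0 h1p)]
    linarith
  calc Mp ≤ Mc / (1 - 2 * d * (1 - γ) * (p - criticalProbI d) * Mc / (γ * (1 - p))) := hup
    _ ≤ Mc / (1 / 2) := div_le_div_of_nonneg_left hMc0.le (by norm_num) hden
    _ = 2 * Mc := by ring

/-- **Below `p_c` the magnetization at most halves inside the field window**: for `d ≥ 2`, `γ ∈ (0,1)`, `0 < q ≤ p_c` with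
`(p_c - q)·M(p_c,γ) ≤ γ(1-p_c)/(2d(1-γ))`: `M(p_c,γ) ≤ 2·M(q,γ)` (from `1/M(q,γ) - 1/M(p_c,γ) ≤ 2d(1-γ)(p_c-q)/(γ(1-p_c)) ≤ 1/M(p_c,γ)`).
[cite: AizenmanBarsky1987, (1.13)] -/
theorem magnetization_criticalProbI_le_two_mul (hd : 2 ≤ d) {γ : ℝ} (hγ0 : 0 < γ) (hγ1 : γ < 1) {q : ℝ} (hq0 : 0 < q)
    (hqc : q ≤ (criticalProbI d : ℝ))
    (hwin : (criticalProbI d - q) * (1 - clusterGF (zdGraph d) (0 : Site d) (criticalProbI d) (1 - γ)) ≤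
      γ * (1 - criticalProbI d) / (2 * d * (1 - γ))) :
    1 - clusterGF (zdGraph d) (0 : Site d) (criticalProbI d) (1 - γ) ≤
      2 * (1 - clusterGF (zdGraph d) (0 : Site d) (GhostField.prm q) (1 - γ)) := by
  have hd1 : 1 ≤ d := by omega
  have hd0 : (0 : ℝ) < d := by exact_mod_cast (show 0 < d by omega)
  have hpc1 : (criticalProbI d : ℝ) < 1 := by rw [coe_criticalProbI]; exact criticalProb_zd_lt_one hd
  have h1p : 0 < 1 - (criticalProbI d : ℝ) := by linarith
  set Mc := 1 - clusterGF (zdGraph d) (0 : Site d) (criticalProbI d) (1 - γ) with hMc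
  set Mq := 1 - clusterGF (zdGraph d) (0 : Site d) (GhostField.prm q) (1 - γ) with hMq
  have hMc0 : 0 < Mc := hγ0.trans_le (gamma_le_one_sub_clusterGF (d := d) (criticalProbI d) hγ0.le hγ1.le)
  have hMq0 : 0 < Mq := hγ0.trans_le (gamma_le_one_sub_clusterGF (d := d) (GhostField.prm q) hγ0.le hγ1.le)
  have h1γ : 0 < 1 - γ := by linarith
  have hinv := inv_magnetization_sub_le hd1 hγ0 hγ1 hq0 hqc hpc1
  rw [show GhostField.prm (criticalProbI d : ℝ) = criticalProbI d from Set.projIcc_val zero_le_one (criticalProbI d)] at hinv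
  change 1 / Mq - 1 / Mc ≤ 2 * d * (1 - γ) * (criticalProbI d - q) / (γ * (1 - criticalProbI d)) at hinv
  -- the window makes the right side `≤ 1/Mc`
  have hK : 2 * d * (1 - γ) * (criticalProbI d - q) / (γ * (1 - criticalProbI d)) ≤ 1 / Mc := by
    rw [div_le_div_iff₀ (mul_pos hγ0 h1p) hMc0]
    have := mul_le_mul_of_nonneg_left hwin (by positivity : (0 : ℝ) ≤ 2 * d * (1 - γ))
    have e : 2 * d * (1 - γ) * (γ * (1 - criticalProbI d) / (2 * d * (1 - γ))) = γ * (1 - criticalProbI d) := by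
      field_simp
    nlinarith [this, e]
  have h2 : 1 / Mq ≤ 2 * (1 / Mc) := by linarith
  have h3 : Mc / Mq ≤ 2 := by
    have := mul_le_mul_of_nonneg_left h2 hMc0.le
    have e1 : Mc * (1 / Mq) = Mc / Mq := by ring
    have e2 : Mc * (2 * (1 / Mc)) = 2 := by field_simp
    linarith [this, e1, e2]
  rwa [div_le_iff₀ hMq0] at h3

/-! ### §2. The two-regime lower bound above `p_c` -/

/-- **`M(p,γ) ≥ max{√(γ/(2dp_c)) - γ/(4dp_c), (p - p_c)/(p(1-p_c))}` for `p_c ≤ p < 1`, `γ ∈ (0,1)`, `d ≥ 2`**: the field regime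
(`δ ≥ 2` by Duminil-Copin–Tassion's route, carried up from `p_c` by monotonicity in `p`) and the thermal regime (`β ≤ 1` for the whole
ghost-field family: `M(p,γ) ≥ M(p_c,γ) + (1 - M(p_c,γ))(p-p_c)/(p(1-p_c)) ≥ (p-p_c)/(p(1-p_c))`).
[cite: DuminilCopinTassionCMP2016, §1.5 (1.12), Prop. 1.3] [cite: AizenmanBarsky1987, Thm. 1.2] -/
theorem magnetization_ge_max (hd : 2 ≤ d) {γ : ℝ} (hγ0 : 0 < γ) (hγ1 : γ < 1) {p : ℝ}
    (hpc : (criticalProbI d : ℝ) ≤ p) (hp1 : p < 1) :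
    max (Real.sqrt (γ / (2 * d * criticalProbI d)) - γ / (4 * d * criticalProbI d))
        ((p - criticalProbI d) / (p * (1 - criticalProbI d))) ≤
      1 - clusterGF (zdGraph d) (0 : Site d) (GhostField.prm p) (1 - γ) := by
  have hd1 : 1 ≤ d := by omega
  have hpc0 : (0 : ℝ) < criticalProbI d := by rw [coe_criticalProbI]; exact criticalProb_zd_pos d hd1
  have hpc1 : (criticalProbI d : ℝ) < 1 := by rw [coe_criticalProbI]; exact criticalProb_zd_lt_one hd
  have hp0 : 0 < p := hpc0.trans_le hpc
  set Mc := 1 - clusterGF (zdGraph d) (0 : Site d) (criticalProbI d) (1 - γ) with hMc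
  set Mp := 1 - clusterGF (zdGraph d) (0 : Site d) (GhostField.prm p) (1 - γ) with hMp
  refine max_le ?_ ?_
  · -- field regime: `√(γ/(2dp_c)) - γ/(4dp_c) ≤ M(p_c,γ) ≤ M(p,γ)`
    refine (magnetization_criticalProbI_ge_sqrt_sub hd hγ0 hγ1).trans ?_
    have hmono := one_sub_clusterGF_mono (d := d) (p := criticalProbI d) (p' := GhostField.prm p)
      (by
        change (criticalProbI d : ℝ) ≤ ((GhostField.prm p : unitInterval) : ℝ)
        rw [show ((GhostField.prm p : unitInterval) : ℝ) = p from
          congrArg Subtype.val (Set.projIcc_of_mem zero_le_one ⟨hp0.le, hp1.le⟩)]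
        exact hpc) hγ0 hγ1
    exact hmono
  · -- thermal regime: increments from `p_c`
    have hinc := magnetization_sub_magnetization_ge hd hγ0 hγ1 (le_refl (criticalProbI d : ℝ)) hpc hp1
    rw [show GhostField.prm (criticalProbI d : ℝ) = criticalProbI d from Set.projIcc_val zero_le_one (criticalProbI d)] at hinc
    change clusterGF (zdGraph d) (0 : Site d) (criticalProbI d) (1 - γ) * ((p - criticalProbI d) / (p * (1 - criticalProbI d))) ≤
      Mp - Mc at hinc
    have hZc : clusterGF (zdGraph d) (0 : Site d) (criticalProbI d) (1 - γ) = 1 - Mc := by rw [hMc]; ring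
    rw [hZc] at hinc
    have hMc0 : 0 ≤ Mc := by
      have := clusterGF_le_one (zdGraph d) (0 : Site d) (criticalProbI d) (t := 1 - γ) (by linarith) (by linarith)
      rw [hMc]; linarith
    have hs1 : (p - criticalProbI d) / (p * (1 - criticalProbI d)) ≤ 1 := by
      rw [div_le_one (mul_pos hp0 (by linarith))]
      nlinarith
    nlinarith [hinc, hMc0, hs1]

/-! ### §3. The derivative gap across `p_c` does not close as `γ ↓ 0` -/

/-- **The slope gap across `p_c` persists as `γ ↓ 0`** (builds on p205010 (kernel theorem, internal audit signed; external expert review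
pending) through `ChiF.eventually_le_deriv_magnetization_criticalProbI`): for `d ≥ 2`, every `p ∈ (0, p_c)` and every `ε > 0`, for all
small `γ > 0`: `∂M/∂p (p_c,γ) - ∂M/∂p (p,γ) ≥ (1 - ε)/(p_c(1-p_c))` — the analytic curves `M(·,γ)` have slope oscillation at least
`≈ 1/(p_c(1-p_c)) ≥ 4` on `[p, p_c]`, uniformly as `γ ↓ 0`, although they converge uniformly to `θ` (Dini): the corner of `θ` at `p_c`.
[cite: DuminilCopinTassionCMP2016, §1.5 (1.12)] [cite: AizenmanBarsky1987, (1.13)] -/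
theorem eventually_deriv_gap_criticalProbI (hd : 2 ≤ d) {p : ℝ} (hp0 : 0 < p) (hpc : p < (criticalProbI d : ℝ)) {ε : ℝ}
    (hε : 0 < ε) :
    ∀ᶠ γ : ℝ in 𝓝[>] 0,
      (1 - ε) / (criticalProbI d * (1 - criticalProbI d)) ≤
        deriv (fun r : ℝ => 1 - clusterGF (zdGraph d) (0 : Site d) (GhostField.prm r) (1 - γ)) (criticalProbI d) -
          deriv (fun r : ℝ => 1 - clusterGF (zdGraph d) (0 : Site d) (GhostField.prm r) (1 - γ)) p := by
  have hd1 : 1 ≤ d := by omega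
  have hpc0 : (0 : ℝ) < criticalProbI d := by rw [coe_criticalProbI]; exact criticalProb_zd_pos d hd1
  have hpc1 : (criticalProbI d : ℝ) < 1 := by rw [coe_criticalProbI]; exact criticalProb_zd_lt_one hd
  have hK : 0 < (criticalProbI d : ℝ) * (1 - criticalProbI d) := mul_pos hpc0 (by linarith)
  -- at `p_c`: `≥ (1 - ε/2)/(p_c(1-p_c))` for `γ ≤ γ₀`
  obtain ⟨γ₀, hγ₀0, hγ₀1, hcrit⟩ := eventually_le_deriv_magnetization_criticalProbI hd (half_pos hε)
  -- at `p < p_c`: the slope tends to `0`, so eventually `≤ (ε/2)/(p_c(1-p_c))`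
  have hsub := tendsto_deriv_magnetization_subcritical hd hp0 hpc
  have hδ : 0 < ε / 2 / (criticalProbI d * (1 - criticalProbI d)) := by positivity
  have hev1 : ∀ᶠ γ : ℝ in 𝓝[>] 0,
      deriv (fun r : ℝ => 1 - clusterGF (zdGraph d) (0 : Site d) (GhostField.prm r) (1 - γ)) p <
        ε / 2 / (criticalProbI d * (1 - criticalProbI d)) :=
    (tendsto_order.1 hsub).2 _ hδ
  have hev2 : ∀ᶠ γ : ℝ in 𝓝[>] 0, γ ∈ Set.Ioo (0 : ℝ) γ₀ := Ioo_mem_nhdsGT hγ₀0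
  filter_upwards [hev1, hev2] with γ h1 h2
  have h3 := hcrit γ h2.1 h2.2.le
  have e : (1 - ε) / (criticalProbI d * (1 - criticalProbI d)) =
      (1 - ε / 2) / (criticalProbI d * (1 - criticalProbI d)) - ε / 2 / (criticalProbI d * (1 - criticalProbI d)) := by
    field_simp; ring
  rw [e]
  linarith

end ChiF

end Summit.CriticalPhenomena.PercolationContinuityZ3.Theorems

end
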